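import Summits.Langlands.Langlands.Theses.OrdinaryPrimeTransport
import Summits.Langlands.Langlands.Theorems.BaseFieldAscentReciprocityTRCMPotentialAutomorphyCMTightness
import Literature.NumberTheory.Automorphic.BLGGT2014PotentialAutomorphy
import Literature.NumberTheory.Automorphic.PolarizedCompatibleSystemRationalModelsProofs
import Literature.NumberTheory.Automorphic.AlgebraicityTwist
import Literature.NumberTheory.GaloisRepresentations.RestrictFieldSelf
import HarnessLib

/-!
# F4 `_onpath` — `Langlands → PotCrystallinePotentialAutomorphyTR` (line `PotCrystallinePotentialAutomorphyTR`,
# crux `ReciprocityUpToIrreducibility`, item stmt-Langlands-14328; G4 ladder-down generation 37)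

Self-contained, sorry-free: the declarations of §§1–3 of `Lines/PotCrystallinePotentialAutomorphyTR.lean` and
the on-path lemma `PotCrystallinePotentialAutomorphyTR_of_Langlands : Langlands → PotCrystallinePotentialAutomorphyTR`
(indeed `family_of_langlands : Langlands → SelfDualPotentialAutomorphy θ` for every `θ`, and
`family_of_top : E → SelfDualPotentialAutomorphy θ`): clause (B) of the summit at any reciprocity datum (one
exists by the `Nonempty` conjunct) applies to every `r` of the cell — the cell's local clause is stated against
the PINNED Fontaine datum `fontainePstAdicCompletion v l hv = Rec.pst l v hv` (`rfl`) and contains de Rham, so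
`IsGeometricFramed Rec r`; `Corresponds Rec ι π r` contains a.e. Satake–Frobenius matching in the summit's
normalisation `m = 1`; and automorphy over `F` is potential weak automorphy with `F' := F` (`Algebra.id`,
`IsGalois.self`, `InfinityType.twist_zero`, `ReciprocityTRCM.satakeFrobCompatibleAt_restrictField_self`:
restriction along `F ≤ F` is a change of frame).
-/

noncomputable section

set_option linter.dupNamespace false

open scoped MatrixGroups Matrix NumberField Classical
open NumberField IsDedekindDomain Field Filter
open Literature.NumberTheory.Automorphic Literature.NumberTheory.GaloisRepresentations
open Literature.NumberTheory.PAdicHodge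
open Summit.Langlands

namespace Summit.Langlands.Langlands.Cruxes.ReciprocityUpToIrreducibility.PotCrystallinePotentialAutomorphyTR

/-! ## 1. The dial clause (the ONE hypothesis that moves: the `p`-adic Hodge type at `v ∣ l`) -/

/-- The **type clause** of the dial, on two propositions `PD` ("potentially diagonalizable for every
instance of compatible crystalline extension data over the pinned datum, and such an instance exists" —
hypothesis (3) of BLGGT Thm. C verbatim) and `PC` ("potentially crystalline": every Weil–Deligne
representation attached to `r|Γ_{F_v}` by the pinned Fontaine datum has `N = 0`):
`θ = 0` — `PD` (the tree's fact); `θ = 1` — `PD ∨ PC` (potentially crystalline; PD ⇒ potentially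
crystalline in print, BLGGT §1.4, the disjunction keeps the cells nested in the tree's abstract
vocabulary); `θ ≥ 2` — no condition beyond de Rham (potentially semistable, any monodromy). -/
def typeClause : ℕ → Prop → Prop → Prop
  | 0, PD, _ => PD
  | 1, PD, PC => PD ∨ PC
  | _ + 2, _, _ => True

@[simp] theorem typeClause_zero (PD PC : Prop) : typeClause 0 PD PC = PD := rfl
@[simp] theorem typeClause_one (PD PC : Prop) : typeClause 1 PD PC = (PD ∨ PC) := rfl
@[simp] theorem typeClause_add_two (θ : ℕ) (PD PC : Prop) : typeClause (θ + 2) PD PC = True := rfl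

/-- The clause only weakens as `θ` grows (nested cells). -/
theorem typeClause_mono {θ θ' : ℕ} (hle : θ ≤ θ') {PD PC : Prop} (h : typeClause θ PD PC) :
    typeClause θ' PD PC := by
  match θ, θ', hle, h with
  | 0, 0, _, h => exact h
  | 0, 1, _, h => exact Or.inl h
  | 1, 1, _, h => exact h
  | _, _ + 2, _, _ => trivial
  | 1, 0, hle, _ => omega
  | _ + 2, 0, hle, _ => omega
  | _ + 2, 1, hle, _ => omega

/-! ## 2. Hypotheses, conclusion, family, rung -/

/-- **Hypothesis (2) of BLGGT Thm. C, verbatim from the tree's fact** (odd essential self-duality): `r`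
maps to `GSp_n` with totally odd multiplier, or to `GO_n` with totally even multiplier. -/
def OddEssSelfDual (F : Type) [Field F] [NumberField F] (l : ℕ) [Fact l.Prime] {n : ℕ}
    (r : FramedGaloisRep F (PadicAlgCl l) n) : Prop :=
  (∃ (J : Matrix (Fin n) (Fin n) (PadicAlgCl l)) (μ : absoluteGaloisGroup F →* (PadicAlgCl l)ˣ),
      Jᵀ = -J ∧ IsUnit J.det ∧
      (∀ g : absoluteGaloisGroup F, (r g).val.transpose * J * (r g).val = (μ g : PadicAlgCl l) • J) ∧
      ∀ (φ : F →+* ℝ) (c : absoluteGaloisGroup F), IsComplexConjugation φ c → μ c = -1) ∨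
    (∃ (J : Matrix (Fin n) (Fin n) (PadicAlgCl l)) (μ : absoluteGaloisGroup F →* (PadicAlgCl l)ˣ),
      J.IsSymm ∧ IsUnit J.det ∧
      (∀ g : absoluteGaloisGroup F, (r g).val.transpose * J * (r g).val = (μ g : PadicAlgCl l) • J) ∧
      ∀ (φ : F →+* ℝ) (c : absoluteGaloisGroup F), IsComplexConjugation φ c → μ c = 1)

/-- **Local cell `θ` at a place `v ∣ l`** (hypothesis (3) of BLGGT Thm. C with its potential
diagonalizability conjunct DIALLED): for Fontaine's PINNED datum `D = fontainePstAdicCompletion v l hv`,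
`r|Γ_{F_v}` is de Rham, has `n` distinct `τ`-labelled Hodge–Tate numbers for every `ℚ_l`-label `τ`, and
satisfies `typeClause θ PD PC`. At `θ = 0` this is the fact's clause (3) symbol for symbol. -/
def LocalCell (θ : ℕ) (F : Type) [Field F] [NumberField F] (l : ℕ) [Fact l.Prime] {n : ℕ}
    (r : FramedGaloisRep F (PadicAlgCl l) n) (v : HeightOneSpectrum (𝓞 F))
    (hv : ((l : ℕ) : 𝓞 F) ∈ v.asIdeal) : Prop :=
  (fontainePstAdicCompletion v l hv).IsDeRhamFramed (r.toLocal v) ∧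
  (letI := (fontainePstAdicCompletion v l hv).algebra
   (∀ τ : v.adicCompletion F →ₐ[ℚ_[l]] PadicAlgCl l,
      (let M := r.labelledHodgeTateWeightsAt v
         (fontainePstAdicCompletion v l hv).algebra (fontainePstAdicCompletion v l hv).𝔅 τ.toRingHom
       M.Nodup ∧ Multiset.card M = n)) ∧
   typeClause θ
     (Nonempty (PstCrystallineExtensionData (fontainePstAdicCompletion v l hv)) ∧
       ∀ 𝔈 : PstCrystallineExtensionData (fontainePstAdicCompletion v l hv),
         IsPotentiallyDiagonalizable 𝔈.𝔅 (r.toLocal v))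
     (∀ r', (fontainePstAdicCompletion v l hv).IsWeilDeligneOf (r.toLocal v) r' → r'.N = 0))

theorem localCell_mono {θ θ' : ℕ} (hle : θ ≤ θ') {F : Type} [Field F] [NumberField F] {l : ℕ}
    [Fact l.Prime] {n : ℕ} {r : FramedGaloisRep F (PadicAlgCl l) n} {v : HeightOneSpectrum (𝓞 F)}
    {hv : ((l : ℕ) : 𝓞 F) ∈ v.asIdeal} (h : LocalCell θ F l r v hv) : LocalCell θ' F l r v hv :=
  ⟨h.1, h.2.1, typeClause_mono hle h.2.2⟩

theorem isDeRhamFramed_of_localCell {θ : ℕ} {F : Type} [Field F] [NumberField F] {l : ℕ}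
    [Fact l.Prime] {n : ℕ} {r : FramedGaloisRep F (PadicAlgCl l) n} {v : HeightOneSpectrum (𝓞 F)}
    {hv : ((l : ℕ) : 𝓞 F) ∈ v.asIdeal} (h : LocalCell θ F l r v hv) :
    (fontainePstAdicCompletion v l hv).IsDeRhamFramed (r.toLocal v) :=
  h.1

/-- **Conclusion shape, NORMALISATION-FREE** ("`r|Γ_{F'}` is weakly automorphic over a finite Galois
totally real `F'/F`"): a cuspidal `π` of `GL_n(𝔸_{F'})` and a normalisation exponent `m : ℕ` such that
`π ⊗ |det|^{(1-m)/2}` is L-algebraic (an infinity type `T` of `π` with `T.twist ((1-m)/2)` L-algebraic) and,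
at almost every place `w` of `F'`, `r|Γ_{F'}` is unramified with `char r(Frob_w) = ∏_j (X - ι⁻¹((q_w^{(m-1)/2} α_j)⁻¹))`
for the Satake parameter `α` of `π_w` (`arithFrobPolyOfSatake ι q_w m α`).  With `m = n` and `π` regular
algebraic this is Harris–Lan–Taylor–Thorne's characterising property of `r_{l,ı}(π)` (the fact's
conclusion, Clozel/Caraiani normalisation `rec(π_w ⊗ |det|^{(1-n)/2})`); with `m = 1` and `π` L-algebraic
it is the summit clause `SatakeFrobCompatibleAt` (Buzzard–Gee).  The fact's extra conjunct
"`r|Γ_{F'}` semisimple" is dropped (weaker). [cite: BuzzardGeeLMS2014, §5 and Conj. 3.2.1]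
[cite: HarrisLanTaylorThorneRMS2016, Thm. A] -/
def PotentiallyWeaklyAutomorphicTR (F : Type) [Field F] [NumberField F] (l : ℕ) [Fact l.Prime] {n : ℕ}
    (ι : PadicAlgCl l ≃+* ℂ) (r : FramedGaloisRep F (PadicAlgCl l) n) : Prop :=
  ∃ (F' : Type) (_ : Field F') (_ : NumberField F') (_ : Algebra F F'),
    IsGalois F F' ∧ IsTotallyReal F' ∧
      ∃ (hcpt : isCompact_glFiniteIntegralLevel n F') (π : CuspidalAutomorphicRepData n F' hcpt) (m : ℕ),
        (∃ T : InfinityType F' n, π.1.HasInfinityType T ∧ (T.twist ((1 - (m : ℂ)) / 2)).IsLAlgebraic) ∧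
        ∀ᶠ w : HeightOneSpectrum (𝓞 F') in cofinite, ∃ α : Multiset ℂ,
          π.1.HasSatakeParamAt w α ∧ (r.restrictField F').IsUnramifiedAt w ∧
            (r.restrictField F').HasFrobCharpolyAt w (arithFrobPolyOfSatake ι w.residueCard m α)

/-- **THE FAMILY** `SelfDualPotentialAutomorphy θ` — BLGGT 2014 Thm. C with its binders copied from the
tree's named fact `BLGGT2014_thmC_potentialAutomorphy` (totally real `F`, `0 < n`, prime `l ≥ 2(n+1)`,
`ι`, `r : Γ_F → GL_n(ℚ̄_l)` a.e. unramified, odd essentially self-dual, `r̄|Γ_{F(ζ_l)}` absolutely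
irreducible), ONE binder ADDED (`r` irreducible — implied in print by (4); weaker statement) and the
local clause (3) at `v ∣ l` replaced by the cell `LocalCell θ`:
`θ = 0` potentially diagonalizable (IN THE TREE as the named fact); `θ = 1` potentially crystalline (THE
RUNG, open); `θ ≥ 2` any de Rham = potentially semistable regular type (open).
[cite: BarnetlambEtAl2014, Theorem C (= Cor. 4.5.2, Thm. 4.5.1), §1.4] -/
def SelfDualPotentialAutomorphy (θ : ℕ) : Prop :=
  ∀ (F : Type) [Field F] [NumberField F], IsTotallyReal F →
    ∀ (n : ℕ), 0 < n → ∀ (l : ℕ) [Fact l.Prime], 2 * (n + 1) ≤ l →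
    ∀ (ι : PadicAlgCl l ≃+* ℂ) (r : FramedGaloisRep F (PadicAlgCl l) n),
      r.toGaloisRep.IsIrreducible →
      (∀ᶠ v : HeightOneSpectrum (𝓞 F) in cofinite, r.IsUnramifiedAt v) →
      OddEssSelfDual F l r →
      (∀ (v : HeightOneSpectrum (𝓞 F)) (hv : ((l : ℕ) : 𝓞 F) ∈ v.asIdeal), LocalCell θ F l r v hv) →
      (r.restrictField (CyclotomicField l F)).IsResiduallyAbsIrreducible →
      PotentiallyWeaklyAutomorphicTR F l ι r

/-- **THE RUNG** (the filed statement): the family at `θ = 1` — BLGGT Thm. C for POTENTIALLY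
CRYSTALLINE (not necessarily potentially diagonalizable) regular `r|Γ_{F_v}` at every `v ∣ l`.  OPEN. -/
def PotCrystallinePotentialAutomorphyTR : Prop := SelfDualPotentialAutomorphy 1

theorem rung_iff_family_one : PotCrystallinePotentialAutomorphyTR ↔ SelfDualPotentialAutomorphy 1 :=
  Iff.rfl

/-! ## 3. (F2) Monotonicity -/

theorem mono {θ θ' : ℕ} (hle : θ ≤ θ') (h : SelfDualPotentialAutomorphy θ') :
    SelfDualPotentialAutomorphy θ := by
  intro F _ _ hF n hn l _ hl ι r hirr hunr hsd hloc hres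
  exact h F hF n hn l hl ι r hirr hunr hsd (fun v hv => localCell_mono hle (hloc v hv)) hres

theorem floor_of_rung (h : PotCrystallinePotentialAutomorphyTR) : SelfDualPotentialAutomorphy 0 :=
  mono (by omega) h

/-- The dial is constant from `θ = 2` on (potentially semistable = every de Rham regular type). -/
theorem family_add_two_iff (θ : ℕ) :
    SelfDualPotentialAutomorphy (θ + 2) ↔ SelfDualPotentialAutomorphy 2 := by
  constructor
  · exact fun h => mono (by omega) h
  · intro h F _ _ hF n hn l _ hl ι r hirr hunr hsd hloc hres
    refine h F hF n hn l hl ι r hirr hunr hsd (fun v hv => ?_) hres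
    obtain ⟨h1, h2, -⟩ := hloc v hv
    exact ⟨h1, h2, by simp⟩

/-! ## 5. (F4) On-path: the summit, and the top E, give every cell with `F' := F`, `m := 1` -/

/-- Weak automorphy over `F` itself (an L-algebraic cuspidal `π` of `GL_n(𝔸_F)`, Satake–Frobenius
compatible with `r` at almost all places in the summit's normalisation `m = 1`) is the family's
conclusion with `F' := F` (`Algebra.id`, `IsGalois.self`; restriction along `F ≤ F` is a change of frame,
`ReciprocityTRCM.satakeFrobCompatibleAt_restrictField_self`). [folklore] -/
theorem potentiallyWeaklyAutomorphicTR_self {F : Type} [Field F] [NumberField F] (hF : IsTotallyReal F)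
    {l : ℕ} [Fact l.Prime] {n : ℕ} (ι : PadicAlgCl l ≃+* ℂ) (r : FramedGaloisRep F (PadicAlgCl l) n)
    {hcpt : isCompact_glFiniteIntegralLevel n F} (π : CuspidalAutomorphicRepData n F hcpt)
    (hL : π.1.IsLAlgebraic)
    (hsat : ∀ᶠ v : HeightOneSpectrum (𝓞 F) in cofinite, SatakeFrobCompatibleAt ι π.1 r v) :
    PotentiallyWeaklyAutomorphicTR F l ι r := by
  refine ⟨F, inferInstance, inferInstance, inferInstance, IsGalois.self F, hF, hcpt, π, 1, ?_, ?_⟩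
  · obtain ⟨T, hT, hTL⟩ := hL
    refine ⟨T, hT, ?_⟩
    have h0 : (1 - ((1 : ℕ) : ℂ)) / 2 = 0 := by norm_num
    rw [h0, InfinityType.twist_zero]
    exact hTL
  · filter_upwards [hsat] with v hv
    exact Theorems.ReciprocityTRCM.satakeFrobCompatibleAt_restrictField_self ι π.1 hv

/-- Clause (B) (Galois → automorphic) over totally real `F` for ONE reciprocity datum gives the family's
conclusion for every `r` in any cell (each cell is de Rham for the pinned datum = `Rec.pst` by `rfl`). -/
theorem family_of_galoisToAutomorphic (θ : ℕ)
    (hB : ∀ (F : Type) [Field F] [NumberField F], IsTotallyReal F →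
      ∃ Rec : ReciprocityData F, ∀ n : ℕ, 0 < n →
        ∀ hcpt : isCompact_glFiniteIntegralLevel n F, GaloisToAutomorphic n Rec hcpt) :
    SelfDualPotentialAutomorphy θ := by
  intro F _ _ hF n hn l _ hl ι r hirr hunr _hsd hloc _hres
  obtain ⟨Rec, hall⟩ := hB F hF
  have hgeo : IsGeometricFramed Rec r := ⟨hunr, fun v hv => isDeRhamFramed_of_localCell (hloc v hv)⟩
  obtain ⟨π, hLalg, hcorr⟩ := hall n hn (isCompact_glFiniteIntegralLevel_holds n F) l ι r hirr hgeo
  exact potentiallyWeaklyAutomorphicTR_self hF ι r π hLalg hcorr.1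

/-- `Langlands → SelfDualPotentialAutomorphy θ` for every `θ`. -/
theorem family_of_langlands (θ : ℕ) (hL : _root_.Langlands) : SelfDualPotentialAutomorphy θ :=
  family_of_galoisToAutomorphic θ fun F _ _ _ => by
    obtain ⟨⟨Rec⟩, hall⟩ := hL F
    exact ⟨Rec, fun n hn hcpt => (hall Rec n hn hcpt).2⟩

/-- **F4 ON-PATH LEMMA for the rung**: `Langlands → PotCrystallinePotentialAutomorphyTR`. -/
@[aesop safe apply]
theorem PotCrystallinePotentialAutomorphyTR_of_Langlands (hL : _root_.Langlands) :
    PotCrystallinePotentialAutomorphyTR :=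
  family_of_langlands 1 hL

/-- `E → SelfDualPotentialAutomorphy θ` (clause (B) of E for its own `Rec`). -/
theorem family_of_top (θ : ℕ)
    (hE : Summit.Langlands.Langlands.Theses.OrdinaryPrimeTransport.ReciprocityUpToIrreducibility) :
    SelfDualPotentialAutomorphy θ :=
  family_of_galoisToAutomorphic θ fun F _ _ _ => by
    obtain ⟨Rec, hall⟩ := hE F
    exact ⟨Rec, fun n hn hcpt => (hall n hn hcpt).2⟩

theorem PotCrystallinePotentialAutomorphyTR_of_top
    (hE : Summit.Langlands.Langlands.Theses.OrdinaryPrimeTransport.ReciprocityUpToIrreducibility) :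
    PotCrystallinePotentialAutomorphyTR :=
  family_of_top 1 hE

end Summit.Langlands.Langlands.Cruxes.ReciprocityUpToIrreducibility.PotCrystallinePotentialAutomorphyTR

end
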